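import Summits.AtomisticToContinuum.HydrodynamicLimit.Theorems.InformationPercolationEngineLocalSecondLawInitialMatchingPointwise
import Summits.AtomisticToContinuum.HydrodynamicLimit.Theorems.JParityClosureLocalSecondLawContactInitialFields
import Summits.AtomisticToContinuum.HydrodynamicLimit.Theorems.JParityClosureLocalSecondLawContactInitialData
import Summits.AtomisticToContinuum.HydrodynamicLimit.Theorems.ImplosionDichotomyHsEosLowDensity

/-!
# Stub B′|ML (`stub_initialMatchingOfStatics`) of the line `contact-asymmetry-information` for the crux `LocalSecondLaw`
(stmt-AtomisticToContinuum-13081) — part 6b: the stub — the initial matching of every bounded tilt GIVEN the one-body statics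

`stub_initialMatchingOfStatics : Stubs.stub_oneBodyStatics → Stubs.stub_initialMatching` of the registered v3 skeleton
`Cruxes/LocalSecondLaw/Lines/contact_asymmetry_information.lean` (texts expanded: the hypothesis is the uniform-in-`g` mean-square
LLN of the canonical hard-sphere gas, LANDED as `LocalSecondLawOneBodyStatics.stub_oneBodyStatics`; the conclusion is the ensemble
frame `EnsFrame` statement B′: for every one-particle density `f` of every bounded pinned tilt `P_N(·|S)`,
`|initialGapEns σ r φ f (P_N(·|S)) Φ (ρ 0) (θ 0)| ≤ η`).

Assembly (`initialMatching_of_oneBodyStatics`).  With `n = ρ(0,·) = ρ₀ = rhoLim (profileOf a₀) σ` (`density_zero_eq_rhoLim`) and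
`θ(0,·) = θ₀` (`contactB_data_zero_eq`), the pointwise gap splits (`pw_hKinBar_sub_Hs_eq`) into
(i) Term 1 `h̄ − A` (`t1_hBar_sub_le`: velocity relative-entropy budget, position-entropy modulus fed by `tv_posDensity_L1_le` —
the ONLY place the statics hypothesis enters — and `tv_posDensity_le_ae`, peculiar-energy matching), made `≤ ε` at fixed `r` by
`N` large; (ii) the smoothing error `A − P(x)` (`initL_coneAvg`, `r < r₁`); (iii) `c₀(ρ̄ − n)` (`contactB_rhoBar_condLaw_lln`, a5);
(iv) the equation of state `ρ̄ f_ex(ρ̄σ³) − n f_ex(nσ³)` (`pw_eos_modulus` inside the band of `hsEosLowDensity_proof`, with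
`σ < η₀/((2e+1)M)` as in the landed initial layer).  Integrating against `φ(0,·) ≥ 0` (both integrands continuous:
`initL_modulus`, `pw_continuous_hKinBar`) gives `|initialGapEns| ≤ 4ε ∫φ(0) ≤ η`.

References: H. Spohn, *Large Scale Dynamics of Interacting Particles* (1991), Part I §2.3–§3; I. Csiszár, Ann. Probab. 3 (1975)
146–158.  Lead c16 (prover-line-stmt-AtomisticToContinuum-13081-c16-0).
-/

noncomputable section

open scoped BigOperators Topology Classical MeasureTheory ENNReal InnerProductSpace
open Filter Set MeasureTheory Function
open Literature.MathematicalPhysics.KineticTheory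
open Literature.MathematicalPhysics.StatisticalMechanics (efR)
open Literature.Analysis.FluidPDE
open Summit.AtomisticToContinuum.HydrodynamicLimit.Theorems.LocalSecondLawNegative
open Summit.AtomisticToContinuum.HydrodynamicLimit.Theorems.LocalSecondLawLedger
open Summit.AtomisticToContinuum.HydrodynamicLimit.Theorems.LocalSecondLawContact

namespace Summit.AtomisticToContinuum.HydrodynamicLimit.Theorems.LocalSecondLawInitialMatching

/-- Eventually-small sequences: `C |log δ″|/(N+1) + C δ″⁻¹ √(K/4/(N+1)) ≤ ε` for `N` large. -/
theorem om_eventually_small (C D K ε : ℝ) (hε : 0 < ε) :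
    ∃ N₀ : ℕ, ∀ N : ℕ, N₀ ≤ N → C * (D / (N + 1)) + C * (K * Real.sqrt (gaussFourthMomentConst (Fin 3) / 4 / (N + 1 : ℕ))) ≤ ε := by
  have hinv : Tendsto (fun N : ℕ => ((N : ℝ) + 1)⁻¹) atTop (𝓝 0) :=
    tendsto_inv_atTop_zero.comp (tendsto_natCast_atTop_atTop.atTop_add tendsto_const_nhds)
  have h1 : Tendsto (fun N : ℕ => C * (D / (N + 1))) atTop (𝓝 0) := by
    have := (hinv.const_mul D).const_mul C
    simpa [div_eq_mul_inv] using this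
  have h2 : Tendsto (fun N : ℕ => C * (K * Real.sqrt (gaussFourthMomentConst (Fin 3) / 4 / (N + 1 : ℕ)))) atTop (𝓝 0) := by
    have h3 : Tendsto (fun N : ℕ => gaussFourthMomentConst (Fin 3) / 4 / (N + 1 : ℕ)) atTop (𝓝 0) := by
      have := hinv.const_mul (gaussFourthMomentConst (Fin 3) / 4)
      rw [mul_zero] at this
      refine this.congr fun N => ?_
      push_cast; ring
    have h4 := (Real.continuous_sqrt.tendsto 0).comp h3
    rw [Real.sqrt_zero] at h4
    have := (h4.const_mul K).const_mul C
    simpa using this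
  have h := h1.add h2
  rw [add_zero] at h
  obtain ⟨N₀, hN₀⟩ := eventually_atTop.1 ((tendsto_order.1 h).2 ε hε)
  exact ⟨N₀, fun N hN => (hN₀ N hN).le⟩

/-- **B′ GIVEN the one-body statics (the stub `stub_initialMatchingOfStatics` of the v3 skeleton, texts expanded).** -/
theorem initialMatching_of_oneBodyStatics : (∀ (P : DensityProfile) (σ : ℝ), SmallDensity P σ → ∀ ε : ℝ, 0 < ε → ∃ N₀ : ℕ, ∀ N : ℕ, N₀ ≤ N → ∀ g : T3 → ℝ, Measurable g → (∀ y, |g y| ≤ 1) → (∫ x, ((((N + 1 : ℕ) : ℝ))⁻¹ * ∑ i, g (x i) - ∫ y, g y * rhoLim P σ y) ^ 2 * Literature.MathematicalPhysics.StatisticalMechanics.efR (Ov (hsDiameter σ N)) x (Finset.univ : Finset (Fin (N + 1))) ∂Measure.pi (fun _ : Fin (N + 1) => P.μ)) / XiN P σ N (N + 1) ≤ ε) → EnsFrame fun σ r τ η φ ρ θ _ Φ μ S => ∀ f, IsOneParticleDensity τ (condLaw μ S) Φ f → |initialGapEns σ r φ f (condLaw μ S) Φ (ρ 0) (θ 0)|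 ≤ η := by
  intro hML a₀ θ₀ u₀ ha hθ hu ha0 hθ0
  -- the equation-of-state band
  obtain ⟨η₀, hη₀, F, hFan, hFeq, -, -, -⟩ := hsEosLowDensity_proof
  have hB : EosBand η₀ F := ⟨hη₀, hFan, hFeq⟩
  set P := profileOf a₀ ha ha0 with hP
  obtain ⟨σ₁, hσ₁, hσ₁half, G1⟩ := DenseExcursionAtTimeZero.density_zero_eq_rhoLim (u₀ := u₀) ha hθ hu ha0 hθ0
  obtain ⟨σ₂, hσ₂, G2⟩ := contactB_data_zero_eq a₀ θ₀ u₀ ha hθ hu ha0 hθ0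
  set Abig : ℝ := (2 * Real.exp 1 + 1) * P.M with hAbig
  have hApos : 0 < Abig := by have := P.M_pos; positivity
  refine ⟨min (min σ₁ σ₂) (min 1 (η₀ / Abig)), by positivity, ?_⟩
  intro σ hσ hσlt T ρ θ u hE Φ hLLN hT τ hτ φ hφ hφ0 hsupp η hη
  have hσ₁' : σ < σ₁ := hσlt.trans_le ((min_le_left _ _).trans (min_le_left _ _))
  have hσ₂' : σ < σ₂ := hσlt.trans_le ((min_le_left _ _).trans (min_le_right _ _))
  have hσ1 : σ < 1 := hσlt.trans_le ((min_le_right _ _).trans (min_le_left _ _))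
  have hσA : σ < η₀ / Abig := hσlt.trans_le ((min_le_right _ _).trans (min_le_right _ _))
  have hσhalf : σ ≤ 1 / 2 := (hσ₁'.trans_le hσ₁half).le
  obtain ⟨hsd, Hid⟩ := G1 σ hσ hσ₁'
  obtain ⟨hρc, huc, hθc⟩ := PolynomialCompressionPDE.continuous_slices_zero hE hT
  have hid : ρ 0 = rhoLim P σ := Hid ρ θ u Φ hρc hLLN
  obtain ⟨hρpos, -, hθid⟩ := G2 σ hσ hσ₂' ρ θ u Φ hρc huc hθc hLLN
  have h0T : (0 : ℝ) ∈ Set.Ico 0 T := ⟨le_rfl, hT⟩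
  have hθpos : ∀ x, 0 < θ 0 x := hE.temperature_pos 0 h0T
  set n : T3 → ℝ := rhoLim P σ with hn
  have hnc : Continuous n := hsd.continuous_rhoLim
  have hnpos : ∀ x, 0 < n x := fun x => by have := hρpos x; rwa [hid] at this
  have hnlt : ∀ x, n x < Abig := fun x => DenseExcursionAtTimeZero.rhoLim_lt hsd x
  have hσ3 : 0 < σ ^ 3 := by positivity
  have hσ3le : σ ^ 3 ≤ σ := by
    have h2 : σ ^ 2 ≤ 1 := by nlinarith
    nlinarith
  have hAband : Abig * σ ^ 3 < η₀ := by
    have hAσ : Abig * σ < η₀ := by rwa [lt_div_iff₀ hApos, mul_comm] at hσA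
    exact lt_of_le_of_lt (mul_le_mul_of_nonneg_left hσ3le hApos.le) hAσ
  have hband : ∀ x, ρ 0 x * σ ^ 3 < η₀ := fun x => by
    rw [hid]
    exact lt_of_le_of_lt (mul_le_mul_of_nonneg_right (hnlt x).le hσ3.le) hAband
  have hprob : ∀ N, IsProbabilityMeasure (localGibbsLaw σ a₀ u₀ θ₀ N (Φ N)) := fun N =>
    isProbabilityMeasure_localGibbsLaw ha hθ hu ha0 hθ0 hσhalf N (Φ N)
  -- the test function at `t = 0` and the tolerance
  have hφc : Continuous (φ 0) := (hφ.isSmooth_slice (Set.mem_univ (0 : ℝ))).continuous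
  set Iφ : ℝ := ∫ x, φ 0 x with hIφ
  have hIφ0 : 0 ≤ Iφ := integral_nonneg (hφ0 0)
  set ε : ℝ := η / (Iφ + 1) / 4 with hε
  have hεpos : 0 < ε := by positivity
  have h4ε : 4 * ε * Iφ ≤ η := by
    rw [hε]
    have : 4 * (η / (Iφ + 1) / 4) * Iφ = η * (Iφ / (Iφ + 1)) := by ring
    rw [this]
    have h1 : Iφ / (Iφ + 1) ≤ 1 := by rw [div_le_one (by positivity)]; linarith
    have h2 := mul_le_mul_of_nonneg_left h1 hη.le
    linarith
  -- (ii) smoothing radius for `Pf = n log n − 3/2 log(2πθ₀) n − 3/2 n`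
  set Pf : T3 → ℝ := fun y => n y * Real.log (n y) - 3 / 2 * Real.log (2 * Real.pi * θ₀ y) * n y - 3 / 2 * n y with hPf
  have hlgc : Continuous fun y => Real.log (2 * Real.pi * θ₀ y) :=
    (continuous_const.mul hθ).log fun y => (mul_pos (by positivity) (hθ0 y)).ne'
  have hPfc : Continuous Pf := ((Real.continuous_mul_log.comp hnc).sub ((hlgc.const_mul _).mul hnc)).sub (hnc.const_mul _)
  obtain ⟨r₁, hr₁, HPf⟩ := MesoLLN.exists_forall_euclidDist_lt_norm_sub_lt hPfc hεpos
  -- (iv) the modulus of the equation of state on `[0, Abig]`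
  obtain ⟨δ₄, hδ₄, HE⟩ := pw_eos_modulus hB hσ hApos.le hAband hεpos
  -- (iii) the mean coarse density of the tilts
  have hc0pos : 0 < c0 := by
    have hlog2π : 0 < Real.log (2 * Real.pi) := Real.log_pos (by linarith [Real.pi_gt_three])
    unfold c0; positivity
  set ε₃ : ℝ := min (ε / (c0 + 1)) (δ₄ / 2) with hε₃
  have hε₃pos : 0 < ε₃ := by positivity
  have hε₃c : c0 * ε₃ ≤ ε := by
    have h1 : ε₃ ≤ ε / (c0 + 1) := min_le_left _ _
    have h2 : c0 * (ε / (c0 + 1)) ≤ ε := by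
      rw [mul_div_assoc', div_le_iff₀ (by positivity)]; nlinarith [hεpos, hc0pos]
    exact (mul_le_mul_of_nonneg_left h1 hc0pos.le).trans h2
  have hε₃δ : ε₃ < δ₄ := (min_le_right _ _).trans_lt (by linarith)
  obtain ⟨r₂, hr₂, HR⟩ := contactB_rhoBar_condLaw_lln hρc Φ hprob hLLN hε₃pos
  -- the pinning resolution (unused) and the radius
  refine ⟨1, one_pos, min (min r₁ r₂) (1 / 4), by positivity, ?_⟩
  intro r hr hrlt δ'' hδ''
  have hrr₁ : r < r₁ := hrlt.trans_le ((min_le_left _ _).trans (min_le_left _ _))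
  have hrr₂ : r < r₂ := hrlt.trans_le ((min_le_left _ _).trans (min_le_right _ _))
  have hrhalf : r ≤ 1 / 2 := (hrlt.trans_le (min_le_right _ _)).le.trans (by norm_num)
  -- (i) Term 1: the constants at this radius and mass floor
  set C : ℝ := 3 / (Real.pi * r ^ 3) with hC
  have hCpos : 0 < C := by positivity
  set K₁ : ℝ := max 1 (max (2 * P.M / δ'') Abig) with hK₁
  have hK₁1 : 1 ≤ K₁ := le_max_left _ _
  have hnK₁ : ∀ y, n y ≤ K₁ := fun y => (hnlt y).le.trans ((le_max_right _ _).trans (le_max_right _ _))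
  obtain ⟨L, hL0, hL⟩ := exists_forall_abs_le_of_continuous hlgc
  set Q : ℝ := (1 + Real.log K₁) + 2 + 3 / 2 * L + 3 / 2 with hQ
  have hlogK₁ : 0 ≤ Real.log K₁ := Real.log_nonneg hK₁1
  have hQpos : 0 < Q := by positivity
  set κ : ℝ := min 1 ((ε / (2 * C * Q)) ^ 2) with hκ
  have hκpos : 0 < κ := by positivity
  have hκ1 : κ ≤ 1 := min_le_left _ _
  have hsqκ : Real.sqrt κ ≤ ε / (2 * C * Q) := by
    rw [Real.sqrt_le_left (by positivity)]
    exact min_le_right _ _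
  obtain ⟨Nκ, Hκ⟩ := tv_posDensity_L1_le ha hθ hu ha0 hθ0 hσhalf hsd hML hκpos hδ''
  obtain ⟨Nbe, Hbe⟩ := om_eventually_small C (|Real.log δ''|) δ''⁻¹ (ε / 2) (by positivity)
  obtain ⟨Nρ, Hρ⟩ := HR r hr hrr₂ δ'' hδ''
  refine ⟨max (max Nκ Nbe) Nρ, fun N hN S hS c _ f hf => ?_⟩
  have hNκ : Nκ ≤ N := le_trans ((le_max_left _ _).trans (le_max_left _ _)) hN
  have hNbe : Nbe ≤ N := le_trans ((le_max_right _ _).trans (le_max_left _ _)) hN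
  have hNρ : Nρ ≤ N := le_trans (le_max_right _ _) hN
  set μ : Measure (Phase N) := localGibbsLaw σ a₀ u₀ θ₀ N (Φ N) with hμ
  haveI : IsProbabilityMeasure μ := hprob N
  set ν : Measure (Phase N) := condLaw μ S with hν
  haveI : IsProbabilityMeasure ν := contactB_condLaw_isProbability_of_floor μ S δ'' hδ'' hS
  have hS0 : μ S ≠ 0 := fun h0 => by
    rw [h0] at hS
    exact absurd (nonpos_iff_eq_zero.1 hS) (by rw [ENNReal.ofReal_eq_zero]; linarith)
  -- the inputs of Term 1 at this `(N, S, f)`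
  have hL1 : ∫ y : T3, |(∫ v : V3, f (0, y, v)) - n y| ≤ κ := Hκ N hNκ (Φ N) S hS τ hτ.le f hf
  have hnSK : ∀ᵐ y : T3, (∫ v : V3, f (0, y, v)) ≤ K₁ := by
    filter_upwards [tv_posDensity_le_ae ha hθ hu ha0 hθ0 hσhalf hsd (Φ N) S hδ'' hS hτ.le hf] with y hy
    exact hy.trans ((le_max_left _ _).trans (le_max_right _ _))
  have hT1 := t1_hBar_sub_le ha hθ hu ha0 hθ0 hσhalf hτ.le (Φ N) S hδ'' hS f hf hnc (fun y => (hnpos y).le)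
    hK₁1 hr hnK₁ hnSK hL1 hL
  -- the budget `b ≤ |log δ″|/(N+1)`
  have hb : Real.log ((localGibbsLaw σ a₀ u₀ θ₀ N (Φ N) S).toReal⁻¹) / (N + 1) ≤ |Real.log δ''| / (N + 1) := by
    refine div_le_div_of_nonneg_right ?_ (by positivity)
    have hδS : δ'' ≤ (localGibbsLaw σ a₀ u₀ θ₀ N (Φ N) S).toReal :=
      (ENNReal.ofReal_le_iff_le_toReal (measure_ne_top μ S)).1 hS
    have h1 : (localGibbsLaw σ a₀ u₀ θ₀ N (Φ N) S).toReal⁻¹ ≤ δ''⁻¹ := by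
      rw [inv_le_inv₀ (hδ''.trans_le hδS) hδ'']; exact hδS
    calc Real.log ((localGibbsLaw σ a₀ u₀ θ₀ N (Φ N) S).toReal⁻¹)
        ≤ Real.log δ''⁻¹ := Real.log_le_log (inv_pos.2 (hδ''.trans_le hδS)) h1
      _ = -Real.log δ'' := Real.log_inv _
      _ ≤ |Real.log δ''| := neg_le_abs _
  -- Term 1 is `≤ ε`
  have hT1ε : ∀ x, |hBar r f 0 x - ∫ y, cone r y x * Pf y| ≤ ε := by
    intro x
    refine (hT1 x).trans ?_
    have hsmall1 : C * (|Real.log δ''| / (N + 1)) + C * (δ''⁻¹ * Real.sqrt (gaussFourthMomentConst (Fin 3) / 4 / (N + 1 : ℕ))) ≤ ε / 2 :=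
      Hbe N hNbe
    have hsmall2 : C * (((1 + Real.log K₁) * κ + 2 * Real.sqrt κ) + 3 / 2 * L * κ + 3 / 2 * κ) ≤ ε / 2 := by
      have hκsq : κ ≤ Real.sqrt κ := by
        have := Real.sqrt_le_sqrt hκ1
        rw [Real.sqrt_one] at this
        calc κ = Real.sqrt κ * Real.sqrt κ := (Real.mul_self_sqrt hκpos.le).symm
          _ ≤ Real.sqrt κ * 1 := mul_le_mul_of_nonneg_left this (Real.sqrt_nonneg _)
          _ = Real.sqrt κ := mul_one _
      have h1 : ((1 + Real.log K₁) * κ + 2 * Real.sqrt κ) + 3 / 2 * L * κ + 3 / 2 * κ ≤ Q * Real.sqrt κ := by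
        have e1 := mul_le_mul_of_nonneg_left hκsq (show (0 : ℝ) ≤ 1 + Real.log K₁ by positivity)
        have e2 := mul_le_mul_of_nonneg_left hκsq hL0
        rw [hQ]; linarith only [Real.sqrt_nonneg κ, e1, e2, hκsq]
      calc C * (((1 + Real.log K₁) * κ + 2 * Real.sqrt κ) + 3 / 2 * L * κ + 3 / 2 * κ) ≤ C * (Q * Real.sqrt κ) :=
            mul_le_mul_of_nonneg_left h1 hCpos.le
        _ ≤ C * (Q * (ε / (2 * C * Q))) := mul_le_mul_of_nonneg_left (mul_le_mul_of_nonneg_left hsqκ hQpos.le) hCpos.le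
        _ = ε / 2 := by
            have hC0 : C ≠ 0 := hCpos.ne'
            have hQ0 : Q ≠ 0 := hQpos.ne'
            field_simp
    have hb' : C * (Real.log ((localGibbsLaw σ a₀ u₀ θ₀ N (Φ N) S).toReal⁻¹) / (N + 1)) ≤ C * (|Real.log δ''| / (N + 1)) :=
      mul_le_mul_of_nonneg_left hb hCpos.le
    rw [hC] at hsmall1 hsmall2 hb'
    linarith only [hsmall1, hsmall2, hb']
  -- the pointwise gap at every centre
  have hpt : ∀ x, |hKinBar σ r f ν (Φ N) 0 x - Hs σ (n x) (θ₀ x)| ≤ 4 * ε := by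
    intro x
    set A : ℝ := ∫ y, cone r y x * Pf y with hA
    set ρb : ℝ := rhoBar r ν (Φ N) 0 x with hρb
    have hρb0 : 0 ≤ ρb := pw_rhoBar_nonneg hr ν (Φ N) 0 x
    have hρbn : |ρb - n x| ≤ ε₃ := by
      have := Hρ N hNρ S hS x
      rwa [hid] at this
    -- (ii) smoothing
    have hAP : |A - Pf x| ≤ ε := by
      have h := initL_coneAvg hPfc hr hrhalf x (ε := ε) fun y hy => (HPf y x (hy.trans hrr₁)).le
      rw [Real.norm_eq_abs] at h
      have e1 : (∫ y, cone r y x • Pf y) = A := by rw [hA]; rfl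
      rwa [e1] at h
    -- (iv) equation of state
    obtain ⟨-, hEOS⟩ := HE (n x) ⟨(hnpos x).le, (hnlt x).le⟩ ρb hρb0 (lt_of_le_of_lt hρbn hε₃δ)
    -- assemble
    rw [pw_hKinBar_sub_Hs_eq f ν (Φ N) x (hnpos x) (hθ0 x) A]
    have e2 : Pf x = n x * Real.log (n x) - 3 / 2 * Real.log (2 * Real.pi * θ₀ x) * n x - 3 / 2 * n x := rfl
    rw [← e2]
    have hc0ρ : |c0 * (ρb - n x)| ≤ ε := by
      rw [abs_mul, abs_of_pos hc0pos]
      exact (mul_le_mul_of_nonneg_left hρbn hc0pos.le).trans hε₃c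
    calc |hBar r f 0 x - A + (A - Pf x) + c0 * (ρb - n x) +
          (ρb * hsExcessFreeEnergy (ρb * σ ^ 3) - n x * hsExcessFreeEnergy (n x * σ ^ 3))|
        ≤ |hBar r f 0 x - A| + |A - Pf x| + |c0 * (ρb - n x)| +
          |ρb * hsExcessFreeEnergy (ρb * σ ^ 3) - n x * hsExcessFreeEnergy (n x * σ ^ 3)| := by
          have a1 := abs_add_le (hBar r f 0 x - A + (A - Pf x) + c0 * (ρb - n x))
            (ρb * hsExcessFreeEnergy (ρb * σ ^ 3) - n x * hsExcessFreeEnergy (n x * σ ^ 3))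
          have a2 := abs_add_le (hBar r f 0 x - A + (A - Pf x)) (c0 * (ρb - n x))
          have a3 := abs_add_le (hBar r f 0 x - A) (A - Pf x)
          linarith
      _ ≤ ε + ε + ε + ε := add_le_add (add_le_add (add_le_add (hT1ε x) hAP) hc0ρ) hEOS.le
      _ = 4 * ε := by ring
  -- the mean coarse density stays in the band, so `h̄_kin(0,·)` is continuous
  have hbandρ : ∀ x, rhoBar r ν (Φ N) 0 x * σ ^ 3 < η₀ := by
    intro x
    have hρbn : |rhoBar r ν (Φ N) 0 x - n x| ≤ ε₃ := by
      have := Hρ N hNρ S hS x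
      rwa [hid] at this
    exact (HE (n x) ⟨(hnpos x).le, (hnlt x).le⟩ _ (pw_rhoBar_nonneg hr ν (Φ N) 0 x) (lt_of_le_of_lt hρbn hε₃δ)).1
  have hh1i : Integrable fun y : T3 => h1 f 0 y := pw_integrable_h1 ha hθ hu ha0 hθ0 hσhalf hsd hτ.le (Φ N) S hδ'' hS f hf
  have hKc : Continuous fun x => hKinBar σ r f ν (Φ N) 0 x :=
    pw_continuous_hKinBar hB hσ hr f ν (Φ N) (pw_continuous_hBar hr hh1i) hbandρ
  obtain ⟨hHc, -⟩ := initL_modulus hB hσ hρc huc hθc hρpos hθpos hband one_pos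
  -- the two integrals of `initialGapEns`
  have hi1 : Integrable fun x => Hs σ (ρ 0 x) (θ 0 x) * φ 0 x := integrable_of_continuous_T3 (hHc.mul hφc)
  have hi2 : Integrable fun x => hKinBar σ r f ν (Φ N) 0 x * φ 0 x := integrable_of_continuous_T3 (hKc.mul hφc)
  have hpt' : ∀ x, |Hs σ (ρ 0 x) (θ 0 x) - hKinBar σ r f ν (Φ N) 0 x| ≤ 4 * ε := by
    intro x
    rw [abs_sub_comm, hid, hθid]
    exact hpt x
  show |initialGapEns σ r φ f ν (Φ N) (ρ 0) (θ 0)| ≤ η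
  unfold initialGapEns
  rw [← integral_sub hi1 hi2]
  calc |∫ x, (Hs σ (ρ 0 x) (θ 0 x) * φ 0 x - hKinBar σ r f ν (Φ N) 0 x * φ 0 x)|
      ≤ ∫ x, |Hs σ (ρ 0 x) (θ 0 x) * φ 0 x - hKinBar σ r f ν (Φ N) 0 x * φ 0 x| := abs_integral_le_integral_abs
    _ ≤ ∫ x, 4 * ε * φ 0 x := by
        refine integral_mono_of_nonneg (ae_of_all _ fun x => abs_nonneg _)
          ((integrable_of_continuous_T3 hφc).const_mul _) (ae_of_all _ fun x => ?_)
        show |Hs σ (ρ 0 x) (θ 0 x) * φ 0 x - hKinBar σ r f ν (Φ N) 0 x * φ 0 x| ≤ 4 * ε * φ 0 x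
        rw [← sub_mul, abs_mul, abs_of_nonneg (hφ0 0 x)]
        exact mul_le_mul_of_nonneg_right (hpt' x) (hφ0 0 x)
    _ = 4 * ε * Iφ := integral_const_mul _ _
    _ ≤ η := h4ε

end Summit.AtomisticToContinuum.HydrodynamicLimit.Theorems.LocalSecondLawInitialMatching

end
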